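import Summits.BirchSwinnertonDyer.BirchSwinnertonDyer.Theorems.ResidualThetaTransportAtTwoSignedMuVanishingAtTwoPlusSel2
import Summits.BirchSwinnertonDyer.BirchSwinnertonDyer.Theorems.ResidualThetaTransportAtTwoSignedMuSeedAtTwoPlusSplitFiniteness
import Literature.NumberTheory.EllipticCurves.Kato2004.Condition1252

/-!
# Line `kato-big-image-member` for crux `SignedMuSeedAtTwoPlus` (stmt-BirchSwinnertonDyer-21438) — crux-ideate r1 k1 (g7)

USE THE SEED'S `∃ A`: MOVE THE CLASS ONTO KATO'S BIG-IMAGE LOCUS, THEN READ THE EULER-SYSTEM DIVISIBILITY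
`μ`-EXACTLY AT THE ONE EXCLUDED PRIME `𝔭 = (2)`.

The crux asks, per habitat⁺ curve `W` (non-CM, `r_an = 0`, good supersingular at `2`, `a₂ = 0`, `Δ_W < 0`), for
SOME congruent member `A` (same mod-2 Galois module, good supersingular at `2`, `a₂(A) = 0`) whose plus signed Selmer
duals over the cyclotomic `ℤ₂`-tower are torsion with `μ = 0`. Every other registered line takes `A := W` (or searches
members for a finite CERTIFICATE). This line chooses `A` to satisfy a HYPOTHESIS OF A THEOREM SCHEME instead:

* **S1 (member selection).** On the habitat `Δ ≡ 5 (mod 8)` up to odd squares (good supersingular reduction at `2`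
  makes `ℚ₂(W[2])` a ramified `S₃`-extension with quadratic resolvent `ℚ₂(√-3)`), so `ℚ(√Δ)` is linearly disjoint from
  `ℚ(ζ_{2^∞})` and, by Dokchitser–Dokchitser (Math. Z. 272 (2012), Thm.: `ρ̄₄` onto ⟺ `ρ̄₂` onto ∧ `Δ ∉ -ℚ×²` ∧
  `j ≠ -4t³(t+8)`; `ρ̄₈` onto ⟺ `ρ̄₄` onto ∧ `Δ ∉ ±2ℚ×²`; onto mod `8` ⟹ onto `2`-adically), FULL `2`-ADIC IMAGE of a
  member `A` of the class ⟺ `j(A) ∉ {-4t³(t+8) : t ∈ ℚ}` — ONE THIN CONDITION on the twisted level-2 line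
  `X_W(2) ≅ ℙ¹`. Hilbert irreducibility with a `2`-adic box (same reduction type and `a₂ = 0` as `W`) and a quadratic
  twist by `d ≡ 1 (mod 8)` with `L(A^d,1) ≠ 0` (Friedberg–Hoffstein; the twist keeps `A[2]`, the local curve at `2`,
  the sign of `Δ` and the `SL₂`-part of the image) give a habitat⁺ member `A` with Kato's condition (12.5.2):
  `Kato2004.ImageContainsSL2 A 2`. The catalogued barrier `EulerSystemBigImageAtSmallImage` is thereby DISCHARGED BY
  CHOICE instead of suffered (the parent card `kato` states KATO-INT@2 for `W` itself and concedes the small-image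
  classes; the route's K3 is typed "up to `2^m`" for the same reason).
* **S2 (THE LEVER, research: Kato's Thm 13.4(3) at the excluded prime `𝔭 = (2)`, `μ`-slice only).** For such an `A`
  Kato's zeta element `z` is an integral `Λ`-adic Euler system for `T₂A` on the cyclotomic `ℤ₂`-tower (Kurihara–Otsuki
  2006 p. 564), `𝐇¹` is `Λ`-free of rank one (`A(ℚ_∞)[2] = 0`), and (12.5.2) holds INTEGRALLY. FLAT (the sibling crux
  21437 in scalar form `v₂(ϖ) + μ(Lminus) = 0`) makes `z` `2`-PRIMITIVE, `z ∉ 2·𝐇¹`, through the plus Coleman map and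
  the `μ`-exact explicit reciprocity law at `2` (the same port input as line `pt-trivial-half` S1). The `𝔽₂⟦T⟧`-slice
  of the Kolyvagin-system bound — "a `Λ`-adic Kolyvagin system that is non-zero modulo `2` forces `μ(𝐇²) = 0`", i.e.
  `length_{(2)}(𝐇²) ≤ length_{(2)}(𝐇¹/Λz) = 0`, the one height-one prime Kato's 13.4(3) excludes by "Assume further
  `p ≠ 2`" (Astérisque 295 p. 226) — then gives `μ(X_fine(A/ℚ_∞)) = 0`, i.e. `Sel₀(ℚ_∞, A[2^∞])[2]` finite: residual
  Conjecture A at `2` FOR THE CHOSEN MEMBER. This is the (F)-half that `fine-plus-split` / `sign-dichotomy` /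
  `theta-symbol-seed` / `pt-trivial-half` all leave as "residual Conjecture A at 2 on the whole habitat⁺" with no
  mechanism (or a class-number certificate); here it is paid by the NON-trivial half of Poitou–Tate on a locus where an
  Euler-system mechanism exists, and S1 moves every class into that locus. For `p` odd the implication
  FLAT ⟹ `μ(X^±) = 0` ⟹ Conjecture A is standard (Kato 17.4 + Kobayashi 2003 Thm 1.3 (i); Coates–Sujatha); the port
  replaces `p ≠ 2` by: residual image `GL₂(𝔽₂) = S₃` acting on `A[2]` as the Steinberg module (cohomologically trivial),
  `τ` = a transvection in `SL₂(ℤ₂) ⊂ ρ(G_{ℚ(ζ_{2^∞})})`, and the finite (not zero: Lawson–Wuthrich 2016) error group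
  `H¹(ℚ(A[2^∞])/ℚ, A[2^∞])`, which is pseudo-null in the `Λ`-adic limit. Only the UPPER bound modulo `2` is used: no
  self-duality sign, no parity, no `λ`.
* **S3–S5 (shared VERBATIM with line `pt-trivial-half`):** FLAT ⟹ the plus-local half (trivial half of Poitou–Tate +
  explicit reciprocity at `2`), the analytic supply at level `N_A`, and the sibling crux 21437 `SignedMuAnalyticAtTwoPlus`
  BY NAME (it applies to `A` because S1 delivers `A` habitat⁺).

Composition (no `sorry` outside the stubs): S1 gives `(A, e)`; S4 the data `(f, ϖ, L±)`; S5 FLAT in scalar form via the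
tree's `signedMuAnalyticAtTwoPlus_iff_padicValRat_add_mu_eq_zero`; S2 (every cyclotomic `κ'`) + S3 feed the LANDED split
`SignedMuAtTwo.FineSplit.splitFiniteness` (p596845) ⟹ `Sel⁺(A/ℚ_∞)[2]` finite ⟹ torsion + `μ = 0` for every finitely
generated plus datum by the SEL2 door `isTorsion_and_mu_eq_zero_iff_finite_selmer_pTorsion` (p580570) ⟹ the crux with
`(A, e)`. Repair census of the stuck stub `stub_residualSeedAtTwo` (birth v4.5): it asked for the seed with NO mechanism
("from print": dead — nothing printed at `p = 2`); this line supplies a mechanism whose only `p = 2`-specific inputs are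
isolated in S2 and whose image hypothesis is met by construction (S1), not assumed of `W`.
BSD is not proved by any of this: `L(A,1) ≠ 0` enters through `r_an(A) = 0` (S1) and FLAT.
-/

open WeierstrassCurve Literature.NumberTheory.EllipticCurves
open Literature.NumberTheory.EllipticCurves.Kobayashi2003
open Literature.NumberTheory.EllipticCurves.Rank1Residual
open Literature.NumberTheory.EllipticCurves.ModularForms
open Summit.BirchSwinnertonDyer.Rank1Residual.Supersingular Summit.BirchSwinnertonDyer.Rank1Residual.X1
open Summit.BirchSwinnertonDyer.BirchSwinnertonDyer.Theses.ResidualThetaTransportAtTwo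
open scoped MatrixGroups ModularForm
open CongruenceSubgroup

-- the Cruxes namespace of this sub repeats the summit name by design (D-0017 nested layout)
set_option linter.dupNamespace false

noncomputable section

namespace Summit.BirchSwinnertonDyer.BirchSwinnertonDyer.Cruxes.SignedMuSeedAtTwoPlus.KatoBigImageMember

/-! ## Vocabulary (all over existing declarations; VERBATIM the currencies of the sibling lines) -/

/-- `Sel₀(ℚ_∞, W[2^∞])[2]` is finite (residual Conjecture A at `(W, 2)`; VERBATIM lines `sign-dichotomy`,
`pt-trivial-half`). -/
def FineResidualFinite (W : WeierstrassCurve ℚ) [W.IsElliptic] (κ : ZpExtension ℚ 2) : Prop :=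
  {s : W.fineSelmerInfty κ | 2 • s = 0}.Finite

/-- The PLUS-LOCAL HALF at `κ` (VERBATIM lines `fine-plus-split` / `pt-trivial-half`): the image of
`Sel⁺(W/ℚ_∞)[2]` in `H¹(ℚ_∞, W[2^∞]) / Sel₀(ℚ_∞, W[2^∞])` is finite. -/
def PlusLocalHalf (W : WeierstrassCurve ℚ) [W.IsElliptic] (κ : ZpExtension ℚ 2) : Prop :=
  ((QuotientAddGroup.mk' (W.fineSelmerInfty κ)) ''
    {x : W.subgroupH1 2 κ.kerSubgroup | x ∈ signedSelmerInfty W κ 1 ∧ 2 • x = 0}).Finite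

/-! ## Registered stub statements -/

/-- **S1 (size L, provable from print; THE MEMBER SWITCH): a BIG-IMAGE habitat⁺ member in every habitat⁺ class.**
For a habitat⁺ curve `W` there is a curve `A/ℚ` (globally minimal model), non-CM, `r_an(A) = 0`, good supersingular
at `2` with `a₂(A) = 0`, `Δ_A < 0`, whose `2`-adic image contains `SL₂(ℤ₂)` on `Gal(ℚ̄/ℚ(ζ_{2^∞}))` (Kato's (12.5.2),
`Kato2004.ImageContainsSL2 A 2` ⟺ `ρ̄_{A,2^n}` onto for all `n`, tree
`imageContainsSL2_iff_forall_hasSurjectiveModNGaloisRep`), together with a Galois-equivariant `A[2] ≃ W[2]`.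
WHY PLAUSIBLY TRUE: habitat ⟹ `Δ ≡ 5 (mod 8)·□`, so by Dokchitser–Dokchitser the only obstruction to a full `2`-adic
image inside the class `X_W(2)(ℚ) ≅ ℙ¹(ℚ)` is the thin set `j = -4t³(t+8)`; Hilbert irreducibility inside the
`2`-adic box of `W` (reduction type and `a₂` are `2`-adically locally constant), then a quadratic twist by
`d ≡ 1 (mod 8)` with `L(A^d, 1) ≠ 0` (Friedberg–Hoffstein 1995 Thm B) — the twist preserves `A[2]`, `A/ℚ₂`, `sign Δ`
and `SL₂(ℤ₂) ⊂ ρ(G_{ℚ(ζ_{2^∞})})` (take `d` with a prime factor outside `2N_A`); `Δ_A < 0` is automatic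
(`Δ_A ≡ Δ_W mod ℚ×²`) and big image ⟹ non-CM. WHY IT MIGHT FAIL: only through a mis-typing of `ImageContainsSL2`
(basis-dependence is excluded by `imageContainsSL2_of_forall_hasSurjectiveModNGaloisRep`) or of `IsGloballyMinimal`
for the twisted model; mathematically it is a theorem-sized statement (HIT with local conditions + FH + DD2012). -/
def BigImageMemberAtTwo : Prop :=
  ∀ (W : WeierstrassCurve ℚ) [W.IsElliptic] [W.IsGloballyMinimal], ¬ W.HasCM → W.analyticRank = 0 →
    GoodSS W 2 → W.frobeniusTrace 2 = 0 → W.Δ < 0 →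
    ∃ (A : WeierstrassCurve ℚ) (_ : A.IsElliptic) (_ : A.IsGloballyMinimal),
      ¬ A.HasCM ∧ A.analyticRank = 0 ∧ GoodSS A 2 ∧ A.frobeniusTrace 2 = 0 ∧ A.Δ < 0 ∧
      Kato2004.ImageContainsSL2 A 2 ∧
      ∃ e : WeierstrassCurve.geomTorsion W (2 : ℤ) ≃+ WeierstrassCurve.geomTorsion A (2 : ℤ),
        ∀ (σ : Field.absoluteGaloisGroup ℚ) (P : WeierstrassCurve.geomTorsion W (2 : ℤ)), e (σ • P) = σ • e P

/-- **S2 (size XL, research — THE LEVER: Kato's Euler-system divisibility read `μ`-exactly at `𝔭 = (2)`, fine part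
only): FLAT ⟹ residual Conjecture A at `2` for BIG-IMAGE habitat⁺ curves.** For a habitat⁺ curve `A` whose `2`-adic
image contains `SL₂(ℤ₂)` on `Gal(ℚ̄/ℚ(ζ_{2^∞}))`, with newform `f`, Néron scalar `ϖ` and a Pollack pair at `2`: IF
`v₂(ϖ) + μ(Lminus) = 0` (FLAT, scalar form of 21437) THEN `Sel₀(ℚ_∞, A[2^∞])[2]` is finite for every cyclotomic `κ`.
Mechanism: (i) `z_Kato ∈ 𝐇¹ = lim H¹(ℤ[1/2N_A, ζ_{2^n}], T₂A)`, `𝐇¹ ≅ Λ` (Kato 13.8/13.14 shape; `A(ℚ_∞)[2] = 0` as `ρ̄`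
is irreducible); (ii) FLAT + `Col⁺(loc₂ z) ≐ ϖ·Lminus` up to a `μ`-free factor (Kobayashi Thm 6.3 / Otsuki 2009 at
`2`) ⟹ `Col⁺(loc₂ z) ∉ 2Λ` ⟹ `z ∉ 2𝐇¹`, so `J = (coordinate of z)` has `length_{(2)}(Λ/J) = 0`; (iii) the
`𝔽₂⟦T⟧`-SLICE of the Euler/Kolyvagin-system bound under integral (12.5.2): `length_{(2)}(𝐇²) ≤ length_{(2)}(Λ/J)`
(Kato 13.4(3) at the prime it excludes; MR Thm 5.3.10-shape with `T/2T = A[2]` the Steinberg module of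
`SL₂(𝔽₂) = S₃`, hence `Hⁱ(S₃, A[2]) = 0`, `τ` a transvection, error group `H¹(ℚ(A[2^∞])/ℚ, A[2^∞])` finite by
Lawson–Wuthrich hence pseudo-null in the limit); (iv) `μ(X_fine) ≤ μ(𝐇²)` (Kato §13.3 / Kurihara: `X_fine ↪ 𝐇²` up to
finite local terms) and `μ(X_fine) = 0 ⟺ Sel₀[2]` finite (tree p570516 currency). WHY IT MIGHT FAIL: every printed
`Λ`-adic Euler/Kolyvagin-system divisibility (Rubin ES Thm 2.3.3–2.3.5, Mazur–Rubin Thm 5.3.10, Kato 13.4(3),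
Kim–Kim–Sun) carries `p > 2`; the `2`-specific danger is an error term of exponent `2` but POSITIVE `𝔽₂⟦T⟧`-rank in
the passage Euler system ⟹ `Λ`-adic Kolyvagin system (the groups `H¹(ℚ_n(A[2^∞])/ℚ_n, A[2^∞])` must have `2`-rank
bounded in `n`), which would weaken (iii) to `μ(𝐇²) ≤ 1`-type bounds — useless for the seed. Cheapest falsifier: one
big-image habitat⁺ curve with an odd even-layer Mazur–Tate coefficient (FLAT) and `rank_{𝔽₂⟦T⟧}` of
`Sel₀(ℚ_n)[2]` growing linearly in `2^n` (kit, layers `n ≤ 4`, e.g. inside the norm-one-torus TSV j297707). -/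
def KatoFineMuSliceAtTwo : Prop :=
  ∀ (A : WeierstrassCurve ℚ) [A.IsElliptic] [A.IsGloballyMinimal], ¬ A.HasCM → A.analyticRank = 0 →
    GoodSS A 2 → A.frobeniusTrace 2 = 0 → A.Δ < 0 → Kato2004.ImageContainsSL2 A 2 →
    ∀ [NeZero (A.conductorNorm ℤ)] (f : CuspForm (Gamma0 (A.conductorNorm ℤ)) 2), IsNewformOf A f →
    ∀ (ϖ : ℚ), (ϖ : ℝ) * A.realPeriodRat = plusPeriod f →
    ∀ (Lplus Lminus : IwasawaAlgebra 2), IsPollackPair f 2 Lplus Lminus →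
    padicValRat 2 ϖ + MuLambda.mu Lminus = 0 →
    ∀ (κ : ZpExtension ℚ 2), κ.IsCyclotomic → FineResidualFinite A κ

/-- **S3 (VERBATIM line `pt-trivial-half` S1, shared; size XL port at `2`): FLAT ⟹ THE PLUS-LOCAL HALF** — trivial
half of Poitou–Tate with Kato's integral class + the `μ`-exact explicit reciprocity law at `2`
(`μ((Sel⁺/Sel₀)^∨) ≤ μ(Col⁺(col z)) = v₂(ϖ) + μ(Lminus)`). WHY IT MIGHT FAIL: a universal period-comparison constant
of the ERL at `2` shifting `μ(ξ)` by a fixed non-zero integer (see that line's docstring). -/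
def FlatPlusLocalHalfAtTwo : Prop :=
  ∀ (W : WeierstrassCurve ℚ) [W.IsElliptic] [W.IsGloballyMinimal], ¬ W.HasCM → W.analyticRank = 0 →
    GoodSS W 2 → W.frobeniusTrace 2 = 0 → W.Δ < 0 →
    ∀ [NeZero (W.conductorNorm ℤ)] (f : CuspForm (Gamma0 (W.conductorNorm ℤ)) 2), IsNewformOf W f →
    ∀ (ϖ : ℚ), (ϖ : ℝ) * W.realPeriodRat = plusPeriod f →
    ∀ (Lplus Lminus : IwasawaAlgebra 2), IsPollackPair f 2 Lplus Lminus →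
    padicValRat 2 ϖ + MuLambda.mu Lminus = 0 →
    ∀ (κ : ZpExtension ℚ 2), κ.IsCyclotomic → PlusLocalHalf W κ

/-- **S4 (VERBATIM line `pt-trivial-half` S3, shared; size S–M): ANALYTIC SUPPLY AT 2 AT LEVEL `N_W`** — non-zero
conductor norm, a newform of level `Γ₀(N_W)` (modularity), a rational Néron scalar `ϖ`, and a Pollack pair at `p = 2`
(Pollack 2003 Thm 5.6 covers `p = 2`, `a₂ = 0`). -/
def AnalyticSupplyAtTwo : Prop :=
  ∀ (W : WeierstrassCurve ℚ) [W.IsElliptic] [W.IsGloballyMinimal], GoodSS W 2 → W.frobeniusTrace 2 = 0 →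
    ∃ (_ : NeZero (W.conductorNorm ℤ)) (f : CuspForm (Gamma0 (W.conductorNorm ℤ)) 2) (ϖ : ℚ)
      (Lplus Lminus : IwasawaAlgebra 2),
      IsNewformOf W f ∧ (ϖ : ℝ) * W.realPeriodRat = plusPeriod f ∧ IsPollackPair f 2 Lplus Lminus

/-! ## The stubs (the ONLY `sorry`s of this file) -/

/-- S1 — the member switch: a big-image habitat⁺ member with an equivariant `A[2] ≃ W[2]` in every habitat⁺ class. -/
theorem stub_bigImageMemberAtTwo : BigImageMemberAtTwo := by
  sorry

/-- S2 — THE LEVER: FLAT ⟹ residual Conjecture A at `2` on the big-image habitat⁺ locus (Kato 13.4(3) at `𝔭 = (2)`,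
`μ`-slice). -/
theorem stub_katoFineMuSliceAtTwo : KatoFineMuSliceAtTwo := by
  sorry

/-- S3 — FLAT ⟹ plus-local half (shared verbatim with `pt-trivial-half` S1). -/
theorem stub_flatPlusLocalHalfAtTwo : FlatPlusLocalHalfAtTwo := by
  sorry

/-- S4 — modularity + rational period scalar + Pollack pair at `2` (shared verbatim with `pt-trivial-half` S3). -/
theorem stub_analyticSupplyAtTwo : AnalyticSupplyAtTwo := by
  sorry

/-- S5 — the SIBLING crux 21437 BY NAME (`SignedMuAnalyticAtTwoPlus`; shared with `pt-trivial-half` S4): an INPUT of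
this line; it applies to the member `A` because S1 delivers `A` habitat⁺. -/
theorem stub_flatAtTwo : SignedMuAnalyticAtTwoPlus := by
  sorry

/-! ## Per-curve reduction (no sorry): FLAT-scalar + fine residual finiteness ⇒ `Sel⁺[2]` finite -/

/-- Per curve and per `κ` (no sorry; hypothesis `h3` = S3): FLAT in scalar form for one analytic datum + the fine
residual finiteness at every cyclotomic `κ'` ⇒ `Sel⁺(A/ℚ_∞)[2]` finite, via the LANDED split
`SignedMuAtTwo.FineSplit.splitFiniteness` (p596845). -/
theorem sel2Finite_of_flat_of_fine (h3 : FlatPlusLocalHalfAtTwo) (A : WeierstrassCurve ℚ) [A.IsElliptic]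
    [A.IsGloballyMinimal] (hCM : ¬ A.HasCM) (hr : A.analyticRank = 0) (hss : GoodSS A 2)
    (ha : A.frobeniusTrace 2 = 0) (hΔ : A.Δ < 0) [NeZero (A.conductorNorm ℤ)]
    (f : CuspForm (Gamma0 (A.conductorNorm ℤ)) 2) (hf : IsNewformOf A f) (ϖ : ℚ)
    (hϖ : (ϖ : ℝ) * A.realPeriodRat = plusPeriod f) (Lplus Lminus : IwasawaAlgebra 2)
    (hP : IsPollackPair f 2 Lplus Lminus) (hflat : padicValRat 2 ϖ + MuLambda.mu Lminus = 0)
    (hF : ∀ κ' : ZpExtension ℚ 2, κ'.IsCyclotomic → FineResidualFinite A κ')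
    (κ : ZpExtension ℚ 2) (γ : Field.absoluteGaloisGroup ℚ) (hκ : κ.IsCyclotomic) (hγ : κ.IsTopGenerator γ) :
    {s : signedSelmerInfty A κ 1 | 2 • s = 0}.Finite := by
  refine Theorems.SignedMuAtTwo.FineSplit.splitFiniteness A κ γ hκ hγ (fun κ' hκ' ↦ ?_)
    (h3 A hCM hr hss ha hΔ f hf ϖ hϖ Lplus Lminus hP hflat κ hκ)
  obtain ⟨γ₀, hγ₀⟩ : ∃ γ₀ : Field.absoluteGaloisGroup ℚ, κ'.IsTopGenerator γ₀ :=
    κ'.surjective (Multiplicative.ofAdd 1)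
  exact (IwasawaModuleFinitePadicInt.exists_fineSelmerDualData_moduleFinite_iff_finite_pTorsion A κ' hγ₀).mpr
    (hF κ' hκ')

/-! ## The skeleton theorem (registrar shape: the ONLY theorem of this file concluding the crux) -/

/-- **THE SKELETON THEOREM: the crux BY NAME from the five declared stubs, glue inlined** (the only `sorry`s in its
closure are `stub_bigImageMemberAtTwo`, `stub_katoFineMuSliceAtTwo`, `stub_flatPlusLocalHalfAtTwo`,
`stub_analyticSupplyAtTwo`, `stub_flatAtTwo`). S1 picks the member `(A, e)`; S4 the analytic data of `A`; FLAT for `A`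
in scalar form from the sibling crux (S5) through `signedMuAnalyticAtTwoPlus_iff_padicValRat_add_mu_eq_zero`; S2 at
every cyclotomic `κ'` + S3 give `Sel⁺(A/ℚ_∞)[2]` finite (`sel2Finite_of_flat_of_fine`); the SEL2 door
`isTorsion_and_mu_eq_zero_iff_finite_selmer_pTorsion` (p580570) converts to torsion + `μ = 0` for every finitely
generated pinned plus dual of `A`. -/
theorem SignedMuSeedAtTwoPlus_of :
    Summit.BirchSwinnertonDyer.BirchSwinnertonDyer.Theses.ResidualThetaTransportAtTwo.SignedMuSeedAtTwoPlus := by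
  intro W _ _ hCM hr hss ha hΔ
  obtain ⟨A, hAe, hAm, hCM', hr', hss', ha', hΔ', hbig, e, he⟩ := stub_bigImageMemberAtTwo W hCM hr hss ha hΔ
  refine ⟨A, hAe, hAm, hss', ha', ⟨e, he⟩, fun κ γ hκ hγ D _ ↦ ?_⟩
  obtain ⟨hN, f, ϖ, Lplus, Lminus, hf, hϖ, hP⟩ := stub_analyticSupplyAtTwo A hss' ha'
  have hflat : padicValRat 2 ϖ + MuLambda.mu Lminus = 0 :=
    (Theorems.SignedMuAtTwo.signedMuAnalyticAtTwoPlus_iff_padicValRat_add_mu_eq_zero.mp stub_flatAtTwo)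
      A hCM' hr' hss' ha' hΔ' f hf ϖ hϖ Lplus Lminus hP
  have hfin : {s : signedSelmerInfty A κ 1 | 2 • s = 0}.Finite :=
    sel2Finite_of_flat_of_fine stub_flatPlusLocalHalfAtTwo A hCM' hr' hss' ha' hΔ' f hf ϖ hϖ Lplus Lminus hP hflat
      (fun κ' hκ' ↦ stub_katoFineMuSliceAtTwo A hCM' hr' hss' ha' hΔ' hbig f hf ϖ hϖ Lplus Lminus hP hflat κ' hκ')
      κ γ hκ hγ
  exact (Theorems.SignedMuAtTwo.isTorsion_and_mu_eq_zero_iff_finite_selmer_pTorsion D).mpr hfin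

end Summit.BirchSwinnertonDyer.BirchSwinnertonDyer.Cruxes.SignedMuSeedAtTwoPlus.KatoBigImageMember

end
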